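import Mathlib

/-!
# Route `AnisotropyChord` / H0 rotor rung: PORT PartN40 — HOLE₂(.75) far pairs: the EXACT two-channel reduction of the two-hole Birman–Schwinger matrix

Verbatim port (modulo this header, the port comment, lint options and docstrings added to the two undocumented
declarations `capacity_decomposition` / `dot4`) of the theory seat's statement file
`hubbard-h0-rotor-theory-1/cycle21/lean/PartN40.lean` (sha16 `e0f25c93cd385c69`, v3 = v1 `2f8dc42d1491e7a9` + §324(f) capacity
decomposition / one-hole skeleton + §327(e) compression bound; theory seat `hubbard-h0-rotor-theory-1` g21, REPORT 30/31,
memo 21 §318/§324/§327; THEOREMS M133/M140).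
Statements (`def … : Prop` targets typed by the theory seat) plus the three lemmas the theory file itself proves
(`channelCapacities_of_shift`, `W_transpose_mul_W`, `capacity_decomposition`); no further proof claimed here.
Prover seat `hubbard-h0-rotor-p2` g0; helper for stmt-HubbardSuperconductivity-19089 (`--supports`, helper class).
WHAT THIS IS NOT: nothing here proves superconductivity in the Hubbard model; the rotor TARGET as originally worded stays
FALSE (g15 verdict) — these are helper statements of ONE conditional reduction (rung 19089: GM₃ ∀L certificate, spectral
input HOLE₂(.75), far-pair branch).  Pure matrix algebra over `ℝ`; Mathlib only; no sorry, no axioms.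

Theory seat's own summary of the file:

# PartN40 — HOLE₂(.75) far pairs: the EXACT two-channel reduction of the two-hole Birman–Schwinger matrix
(theory-1 g21, memo 21 §318/§324; THEOREMS M133/M140)

Setting (memo §314): for a deleted pair `ζ = {0, d}` whose crosses `B₀ = {±e₁, ±e₂}`, `B_d = d + B₀` are disjoint
and non-adjacent, the positivity matrix is `P = −(A⁻¹)_BB − ½·1 + [Λ/(Λs − 1)] x_B x_Bᵀ`, `A = (a(p − q))` on the
10-point set `S = S₀ ∪ (d − S₀)`, `S₀ = {0} ∪ B₀`, `x = A⁻¹1`, `s = Σx`, `Λ` = capacity. The point reflection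
`p ↦ d − p` gives `A = fromBlocks A₀ M M A₀` with `A₀ = (a(p−q))_{p,q∈S₀}` (one cluster) and the symmetric
HANKEL coupling `M_{pq} = a(d − p − q)`.

* `oneHoleP A Λ` — the one-hole map (kernel matrix on `S₀ = Fin 5`, index `0` = centre; boundary = `Fin.succ`).
* `twoHoleP A Λ` — the two-hole map on `Fin 5 ⊕ Fin 5`.
* `CapacityShift` — `P₁[A + c·11ᵀ, Λ] = P₁[A, Λ − c]` (Sherman–Morrison).
* `TwoChannelReduction` — `Wᵀ · P · W = 2 · fromBlocks (P₁[A₀ + M, 2Λ]) 0 0 (P₁[A₀ − M, 0])`, `W = fromBlocks 1 1 1 (−1)`: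
  the EVEN channel is a one-hole problem with kernel `A₀ + M` at capacity `2Λ`, the ODD channel one with kernel
  `A₀ − M` at capacity `0` (no rank-one term). With `M = a(d)·11ᵀ + E_d` and `CapacityShift`:
  `P_± ≅ P₁[A₀ ± E_d, C_±]`, `C₊ = 2Λ − a(d)`, `C₋ = a(d)` — THEOREM H2F's capacities `G(0) ± G(d)`.
Verified numerically to `1e−14` (spectra, `L = 64, 128`, several `d`; memo §324). Pure matrix algebra; Mathlib only.
-/

-- Port of theory seat `hubbard-h0-rotor-theory-1` cycle21/lean/PartN40.lean (sha16 e0f25c93cd385c69) verbatim modulo this header,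
-- lint options and lint fixes; prover seat `hubbard-h0-rotor-p2` g0, `--supports stmt-HubbardSuperconductivity-19089`.

set_option linter.dupNamespace false
open scoped BigOperators
open Matrix

namespace Summit.HubbardSuperconductivity.HubbardSuperconductivity.Theorems.AnisotropyChord.Transfer.Fibre3

namespace TwoChannel

/-- the all-ones matrix on the cluster. -/
def J5 : Matrix (Fin 5) (Fin 5) ℝ := Matrix.of fun _ _ => 1

/-- harmonic-measure vector `x = A⁻¹ 1` of a cluster kernel matrix. -/
noncomputable def xvec (A : Matrix (Fin 5) (Fin 5) ℝ) : Fin 5 → ℝ := A⁻¹.mulVec (fun _ => 1)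

/-- `s = 1ᵀ A⁻¹ 1`. -/
noncomputable def svec (A : Matrix (Fin 5) (Fin 5) ℝ) : ℝ := ∑ i, xvec A i

/-- ONE-HOLE map: `P₁[A, Λ] = −(A⁻¹)_BB − ½·1 + [Λ/(Λs − 1)] x_B x_Bᵀ` on the boundary `B = Fin.succ '' Fin 4`
(at `Λ = 0` the rank-one coefficient is `0`). -/
noncomputable def oneHoleP (A : Matrix (Fin 5) (Fin 5) ℝ) (Λ : ℝ) : Matrix (Fin 4) (Fin 4) ℝ :=
  Matrix.of fun i j =>
    -(A⁻¹) i.succ j.succ + Λ / (Λ * svec A - 1) * xvec A i.succ * xvec A j.succ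
      - (if i = j then (1 : ℝ) / 2 else 0)

/-- boundary embedding of the two clusters. -/
def emb : Fin 4 ⊕ Fin 4 → Fin 5 ⊕ Fin 5 := Sum.map Fin.succ Fin.succ

/-- harmonic-measure vector of the 10-point kernel matrix. -/
noncomputable def xvec2 (A : Matrix (Fin 5 ⊕ Fin 5) (Fin 5 ⊕ Fin 5) ℝ) : Fin 5 ⊕ Fin 5 → ℝ :=
  A⁻¹.mulVec (fun _ => 1)

/-- `s` of the 10-point kernel matrix. -/
noncomputable def svec2 (A : Matrix (Fin 5 ⊕ Fin 5) (Fin 5 ⊕ Fin 5) ℝ) : ℝ := ∑ i, xvec2 A i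

/-- TWO-HOLE map for disjoint non-adjacent crosses (every boundary point has exactly one deleted neighbour):
`P = −(A⁻¹)_BB − ½·1 + [Λ/(Λs − 1)] x_B x_Bᵀ`. -/
noncomputable def twoHoleP (A : Matrix (Fin 5 ⊕ Fin 5) (Fin 5 ⊕ Fin 5) ℝ) (Λ : ℝ) :
    Matrix (Fin 4 ⊕ Fin 4) (Fin 4 ⊕ Fin 4) ℝ :=
  Matrix.of fun i j =>
    -(A⁻¹) (emb i) (emb j) + Λ / (Λ * svec2 A - 1) * xvec2 A (emb i) * xvec2 A (emb j)
      - (if i = j then (1 : ℝ) / 2 else 0)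

/-- CAPACITY SHIFT (Sherman–Morrison; memo §324): adding a constant to the kernel matrix lowers the capacity,
`P₁[A + c·11ᵀ, Λ] = P₁[A, Λ − c]` (`x' = x/(1+cs)`, `s' = s/(1+cs)`). -/
def CapacityShift : Prop :=
  ∀ (A : Matrix (Fin 5) (Fin 5) ℝ) (c Λ : ℝ),
    IsUnit A.det → 1 + c * svec A ≠ 0 → (Λ - c) * svec A - 1 ≠ 0 →
      oneHoleP (A + c • J5) Λ = oneHoleP A (Λ - c)

/-- the (unnormalised) even/odd change of basis on the two boundaries, `WᵀW = 2`. -/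
def W : Matrix (Fin 4 ⊕ Fin 4) (Fin 4 ⊕ Fin 4) ℝ := Matrix.fromBlocks 1 1 1 (-1)

/-- ★ TWO-CHANNEL REDUCTION (exact; memo §318(g),(h), §324): for a reflection-symmetric pair,
`Wᵀ · P[fromBlocks A₀ M M A₀, Λ] · W = 2 · fromBlocks (P₁[A₀ + M, 2Λ]) 0 0 (P₁[A₀ − M, 0])`.
(Even vectors `(φ,φ)`: `A⁻¹` acts as `(A₀+M)⁻¹`, `xᵀψ = 2x₊ᵀφ`, `s = 2s₊` ⇒ capacity `2Λ`; odd vectors `(χ,−χ)`: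
`(A₀−M)⁻¹`, `xᵀψ = 0` ⇒ no rank-one term, i.e. capacity `0`.) -/
def TwoChannelReduction : Prop :=
  ∀ (A₀ M : Matrix (Fin 5) (Fin 5) ℝ) (Λ : ℝ),
    A₀.IsSymm → M.IsSymm → IsUnit (A₀ + M).det → IsUnit (A₀ - M).det →
    Λ * svec2 (Matrix.fromBlocks A₀ M M A₀) - 1 ≠ 0 →
      Wᵀ * twoHoleP (Matrix.fromBlocks A₀ M M A₀) Λ * W
        = (2 : ℝ) • Matrix.fromBlocks (oneHoleP (A₀ + M) (2 * Λ)) 0 0 (oneHoleP (A₀ - M) 0)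

/-- COROLLARY shape (THEOREM H2F, memo §318(g)): with `M = a(d)·J5 + E` the channels are one-hole problems with kernels
`A₀ ± E` at the capacities `C₊ = 2Λ − a(d)`, `C₋ = a(d)`. -/
def ChannelCapacities : Prop :=
  ∀ (A₀ E : Matrix (Fin 5) (Fin 5) ℝ) (ad Λ : ℝ),
    IsUnit (A₀ + E).det → IsUnit (A₀ - E).det →
    1 + ad * svec (A₀ + E) ≠ 0 → (2 * Λ - ad) * svec (A₀ + E) - 1 ≠ 0 →
    1 + (-ad) * svec (A₀ - E) ≠ 0 → (0 - (-ad)) * svec (A₀ - E) - 1 ≠ 0 →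
      oneHoleP (A₀ + E + ad • J5) (2 * Λ) = oneHoleP (A₀ + E) (2 * Λ - ad) ∧
      oneHoleP (A₀ - E + (-ad) • J5) 0 = oneHoleP (A₀ - E) ad

/-- `ChannelCapacities` is two instances of `CapacityShift`. -/
theorem channelCapacities_of_shift (h : CapacityShift) : ChannelCapacities := by
  intro A₀ E ad Λ hp hm h1 h2 h3 h4
  refine ⟨h (A₀ + E) ad (2 * Λ) hp h1 h2, ?_⟩
  have := h (A₀ - E) (-ad) 0 hm h3 h4
  simpa using this

/-- sanity: `WᵀW = 2`. -/
theorem W_transpose_mul_W : Wᵀ * W = (2 : ℝ) • (1 : Matrix (Fin 4 ⊕ Fin 4) (Fin 4 ⊕ Fin 4) ℝ) := by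
  simp only [W, Matrix.fromBlocks_transpose, Matrix.transpose_one, Matrix.transpose_neg,
    Matrix.fromBlocks_multiply]
  ext i j
  rcases i with i | i <;> rcases j with j | j <;>
    simp [Matrix.fromBlocks, Matrix.one_apply, Matrix.smul_apply] <;>  -- port: unused simp arg `two_smul` dropped (lint)
    split_ifs <;> norm_num


/-! ## Capacity monotonicity and the one-hole ℤ² skeleton (memo §324(f)) -/

/-- CAPACITY DECOMPOSITION: `P₁[A, C] = P₁[A, ∞] + x_B x_Bᵀ/(s(Cs − 1))` where `P₁[A, ∞] := −(A⁻¹)_BB − ½ + x_B x_Bᵀ/s`;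
in particular `P₁[A,C]` is DECREASING in `C` (Loewner) for `Cs > 1`, and the margin at large capacity is carried by the
rank-one term (`κ/C` law, memo §317). Pure algebra: `C/(Cs−1) = 1/s + 1/(s(Cs−1))`. -/
noncomputable def oneHolePinf (A : Matrix (Fin 5) (Fin 5) ℝ) : Matrix (Fin 4) (Fin 4) ℝ :=
  Matrix.of fun i j => -(A⁻¹) i.succ j.succ + xvec A i.succ * xvec A j.succ / svec A
      - (if i = j then (1 : ℝ) / 2 else 0)

/-- ★ CAPACITY DECOMPOSITION (PROVED by the theory seat; memo §324(f)): `P₁[A, C] = P₁[A, ∞] + x_B x_Bᵀ/(s(Cs − 1))`.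
[port: docstring added — the typed source documents this at `oneHolePinf`.] -/
theorem capacity_decomposition (A : Matrix (Fin 5) (Fin 5) ℝ) (C : ℝ) (hs : svec A ≠ 0)
    (hC : C * svec A - 1 ≠ 0) :
    oneHoleP A C = oneHolePinf A
      + Matrix.of fun i j => xvec A i.succ * xvec A j.succ / (svec A * (C * svec A - 1)) := by
  ext i j
  simp only [oneHoleP, oneHolePinf, Matrix.of_apply, Matrix.add_apply]
  have key : C / (C * svec A - 1) = 1 / svec A + 1 / (svec A * (C * svec A - 1)) := by
    field_simp
    ring
  rw [key]
  ring

/-- the ONE-hole ℤ² skeleton kernel matrix (walk units: `a(1,0) = 1/2`, `a(1,1) = 2/π`, `a(2,0) = 2 − 4/π`;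
index `0` = centre, `1..4` = `e₁, −e₁, e₂, −e₂`). -/
noncomputable def A0inf : Matrix (Fin 5) (Fin 5) ℝ :=
  Matrix.of fun i j =>
    if i = j then 0
    else if i = 0 ∨ j = 0 then 1 / 2
    else if (i = 1 ∧ j = 2) ∨ (i = 2 ∧ j = 1) ∨ (i = 3 ∧ j = 4) ∨ (i = 4 ∧ j = 3) then 2 - 4 / Real.pi
    else 2 / Real.pi

/-- ONE-HOLE SKELETON STRUCTURE (recurrence of ℤ²; memo §317/§324(f)): `P₁[A₀^∞, ∞] ⪰ 0`, its null space is spanned by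
`1_B` (harmonic support: `x_centre = 0`, `x_B ∝ 1_B`), and the next eigenvalue is `g₀ ≈ .87` (p-channel; d-channel ≈ 1.33).
Stated as: the quadratic form is nonnegative and vanishes exactly on multiples of `1_B`, with the quantitative gap `0.8`. -/
def OneHoleSkeleton : Prop :=
  (∀ v : Fin 4 → ℝ, 0 ≤ dotProduct v ((oneHolePinf A0inf).mulVec v)) ∧
  (oneHolePinf A0inf).mulVec (fun _ => 1) = 0 ∧
  (∀ v : Fin 4 → ℝ, dotProduct v (fun _ => (1 : ℝ)) = 0 →
      (0.8 : ℝ) * dotProduct v v ≤ dotProduct v ((oneHolePinf A0inf).mulVec v))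

/-! ### v3 (memo 21 §327(e)): the 2×2 COMPRESSION BOUND — the load-bearing glue of THEOREM H2F.
For a symmetric `P` (a channel matrix `Pinf(A_±)`), `ρ ≥ 0` and `x = x_B`, with `u = 1_B/2`:
`η = ⟨u,Pu⟩`, `res = ‖Pu − ηu‖`, `g` = a lower bound of `P` on `u^⊥`, `a = ⟨u,x⟩`, `xp = ‖x − a u‖`; then
`P + ρ x xᵀ ⪰ λ₋ := ½[(η + ρa² + g) − √((η + ρa² − g)² + 4(ρ|a|·xp + res)²)]`.
Numerically (hole2_h2f_lb.py) `λ₋/true = .998–1.000` in the even channel for every `d` and `L = 64…1024`, worst `λ₋ = .0906/.0679/.0547`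
at `d = (3,0)` vs `1/(8Λ_L) = .0604/.0498/.0424`. Pure linear algebra (Cauchy–Schwarz on the cross term + 2×2 eigenvalue); prover-sized. -/

/-- `u = 1_B/2` (unit vector). -/
noncomputable def uHalf : Fin 4 → ℝ := fun _ => 1 / 2

/-- the Euclidean inner product on `Fin 4 → ℝ`, `Σ_i v_i w_i`. [port: docstring added.] -/
def dot4 (v w : Fin 4 → ℝ) : ℝ := ∑ i, v i * w i

/-- ★ COMPRESSION BOUND (statement). Hypotheses: `P` symmetric; `g` bounds `P` from below on vectors orthogonal to `u`; `res²` bounds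
`‖Pu − ηu‖²`; `xp²` = ‖x − a u‖²; conclusion: the quadratic form of `P + ρ x xᵀ` is `≥ λ₋‖v‖²`. -/
def CompressionBound : Prop :=
  ∀ (P : Matrix (Fin 4) (Fin 4) ℝ) (x : Fin 4 → ℝ) (ρ g res xp : ℝ),
    P.IsSymm → 0 ≤ ρ → 0 ≤ res → 0 ≤ xp →
    (∀ w : Fin 4 → ℝ, dot4 uHalf w = 0 → g * dot4 w w ≤ dot4 w (P.mulVec w)) →
    (let η := dot4 uHalf (P.mulVec uHalf)
     dot4 (fun i => P.mulVec uHalf i - η * uHalf i) (fun i => P.mulVec uHalf i - η * uHalf i) ≤ res ^ 2) →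
    (let a := dot4 uHalf x
     dot4 (fun i => x i - a * uHalf i) (fun i => x i - a * uHalf i) = xp ^ 2) →
    ∀ v : Fin 4 → ℝ,
      (let η := dot4 uHalf (P.mulVec uHalf)
       let a := dot4 uHalf x
       ((η + ρ * a ^ 2 + g) - Real.sqrt ((η + ρ * a ^ 2 - g) ^ 2 + 4 * (ρ * |a| * xp + res) ^ 2)) / 2)
        * dot4 v v
        ≤ dot4 v (P.mulVec v) + ρ * (dot4 x v) ^ 2

end TwoChannel

end Summit.HubbardSuperconductivity.HubbardSuperconductivity.Theorems.AnisotropyChord.Transfer.Fibre3
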